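import Literature.MathematicalPhysics.QuantumFieldTheory.Balaban1983to89.B2Eq265TailsScale

/-!
# `Balaban1983to89.B2Eq265PrintedSize` — [Balaban1982Higgs2] Lemma 2.4 (2.65) p.572, value clause, on the (Higgs)₂,₃ carrier of record: THE
# FIVE NON-TAIL TERMS OF F18a's BOUND (= F15's at a free physical scale `s`) GROUPED BY THEIR PRINTED SOURCES — (2.65)'s remainder ≤
# [tails `O(s^κ)`, `s ⇐ Lᵏε` the free physical scale of own F18a, now including the `e^{−(R₁+1)/(4K₀)}` tail of (2.76)] + [`4K₀·d·C₃·a_k·λ_A`, `λ_A = (Lᵏε)·c₁pℓ` the covariant Lipschitz constant of (2.55)₃ — print's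
# «O(p(Lᵏε))» of (2.65), from the two displayed lines of p.573 before (2.75)] + [`t′·X·(Lᵏε)·Poly(a_k, K₀, X·Lᵏε)`, `X := |e|·δ_A·d·LᵏS` the
# charge × oscillation product behind print's «A^{(k)} − A₀ = O(p(Lᵏε)r(Lᵏε))», the «O((Lᵏε)^{κ₀})» of (2.68) and of the closing transport
# line «U(A₀(Γ_{x,y}))φ(y) = U(A^{(k)}(Γ^{(k)}_{x,y}))φ(y) + O((Lᵏε)^{κ₀})» p.573] + [(2.75)'s mass ratio
# `m²(Lᵏε)²/(a_k + m²(Lᵏε)²)·t′`] (`eq265_higgs_region_size`), and the same for print's own tower regions (`eq265_higgs_tower_size`)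

statement-level skeleton of published theorems with citation tags; proofs where landed; nothing here is a claim
about the Yang–Mills mass gap

PDF held: `paper:balaban1982-cmp86-higgs23-ii` (journal page = PDF page + 554), p. 572 [PDF 18] (Lemma 2.4; (2.67); «From the property (2.60)
we have the inequality |A^{(k)}(x) − A^{(k)}(y)| ≤ O(p(Lᵏε)r(Lᵏε)). Let us denote by A₀ a constant configuration equal to A^{(k)}(y) at each
point, thus A^{(k)} − A₀ = O(p(Lᵏε)r(Lᵏε))»; (2.68) «… + O((Lᵏε)^{κ₀}), κ₀ > 0»), p. 573 [PDF 19] («|U(A^{(k)}(⟨y′,y″⟩))φ(y″) − φ(y′)| ≤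
O(1)p(Lᵏε)» ⇒ «|φ′(y″) − φ′(y′)| ≤ O(1)p(Lᵏε)»; (2.75); (2.76)), p. 570 [PDF 16] ((2.55)/(2.56)), p. 558 [PDF 4] ((2.7)).

CITATION HEADER (lean-in-tree rule).  T. Bałaban, *(Higgs)₂,₃ quantum fields in a finite volume. II. An upper bound*,
Commun. Math. Phys. **86** (1982) 555–594, doi:10.1007/bf01214890 [Balaban1982Higgs2].  Cell `lit-balaban` (HOME
`run/shared/lean/pub/lit-balaban/`), Phase-2 proof seat **p23** gen 23 (unit `lit-balaban-p23-g23`; free-target protocol G.5-34(d), TAKING #3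
+ AMENDMENT line HOME/STATUS.md 2026-08-23); SKELETON row **B2.Lem2.4** (fold owner r02, second reader r14; head `proved p250408 · …` UNCHANGED —
cells-only member, brick F18 = successor item (iii) of HOME/HANDOFF § p23 gen 22 «the final SIZE of the five non-tail terms»).  USED BY NAME,
never restated: own F18a `B2Eq265TailsScale.eq265_higgs_region_pow_scale` (F15 `B2Eq265TailsPow.eq265_higgs_region_pow` at a free physical
scale `s ∈ (0, 1]`, fold owner's ruling on Q-p23g23-1); r14's `B2StepK.rDecayBeatsPowers_of_printed` (at `s`); b2b's `B2.rFn`, `B1.aSeq`;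
for the tower form the typer's `towerRegion`/`prime`/`near` and own `nbhd_towerRegion`, `isBigBlockUnion_towerRegion_prime`,
`prime_towerRegion_six_subset_two`, p15's `blockIter_toFinest` (as in F14/F16/F18a).

THE ARGUMENT (pure bookkeeping over F18a's seven terms; LATTICE letters `ℓ := P.mesh k`, `ε := P.mesh 0` (`εLᵏ = ℓ`), `a = a_k`,
`t′ = c₁·tPhi·pℓ`, `σ = δ_A·d·LᵏS`, `X = |e|σ`, `M = X·ε·d(Lᵏ − 1) ≤ X·d·ℓ` since `ε(Lᵏ − 1) ≤ εLᵏ = ℓ`; the free PHYSICAL scale `s ∈ (0, 1]`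
enters only the readings and the tails).  (2.68)'s term is
`D₁[aMt′ + Xd(at′D₄ℓ + 2ℓ²XaD₃t′) + a(2M + M²)aD₃t′] + D₂ℓXaD₃t′` (the `ℓ²·ℓ⁻²` cancelled), monotone in `M`; with `M ≤ Xdℓ`,
(2.76)'s middle `4K₀dC₃aℓXt′` and the transport term `Mt′ ≤ Xdℓt′` it sums EXACTLY to `t′Xℓ·[a(E₁ + 4K₀dC₃) + d + E₂a² + Xℓa(E₂ + E₃a)]`,
`E₁ = D₁d(1 + D₄) + D₂D₃`, `E₂ = 2D₁D₃d`, `E₃ = D₁D₃d²`; (2.76)'s first piece is `4K₀dC₃a·λ_A`; its tail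
`aC₃e^{−(R₁+1)/(4K₀)}t′ ≤ C₃E⁺T·a·s^κ` exactly as F18a/F15 treated the (2.67) tails (`R₁ + 1 ≥ θ₂r(s)`, `t′ ≤ Ts^{−m′}`, r14's lemma).

WHAT THIS FILE PROVES (kernel-checked, zero `sorry`; theorems only — NO definition, NO `Prop`-valued fact; axioms standard).
 **`bracket_le`** — the displayed algebra as an inequality between real polynomials (hypotheses: the signs and `ε·d(Lᵏ−1) ≤ d·ℓ`).
 **`eq265_higgs_region_size`** — F18a's `eq265_higgs_region_pow_scale` word for word except (located edits): `∃ E₁ E₂ E₃ ≥ 0` appended to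
 the constants; ONE extra sign hypothesis `0 ≤ tA →` after `0 ≤ tPhi →` ((2.55)₂'s threshold, print's `1/(μ₀L^{k−1}ε) > 0`; it makes
 `δ_A ≥ 0`); and the bound's five non-tail terms REPLACED by the three groups above (the first summand `C′·a_k·s^κ` kept, `C′` enlarged by the
 (2.76) tail).
 **`eq265_higgs_tower_size`** — the same for print's own tower regions: F18a's `eq265_higgs_tower_pow_scale` with the same located edits
 (`K₀ ↦ M`, level `j + 1`); derived from `eq265_higgs_region_size` by F14's/F16's tower lemmas exactly as F18a's tower form (`rad` data).

HONEST SCOPE / DIFFERENCES FROM PRINT (recorded, not hidden; one sentence each).  (a) BOOKKEEPING ONLY: no term is estimated anew — the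
grouping exhibits which printed quantity drives each piece; the SIZES of `λ_A` («O(p(Lᵏε))»), of `X` («e(Lᵏε)·O(p(Lᵏε)r(Lᵏε))`) and of
`t′·X` in the printed scaling (2.5)/(I.1.23) of `e(·), λ(·), p(·)` are NOT evaluated here (they are readings of the free letters `c₁, pℓ,
tPhi, |C.e|, δ_A, S`; the groups are written in the LATTICE letters `P.mesh k`, `P.mesh 0`, `Lᵏ` exactly as F13 produced them, only the
tails and the readings at the free physical scale `s` — the row's reading question Q-p23g23-1, seat INBOX r02 2026-08-23, is thereby left
to the user as in F18a).  (b) `E₁…E₃` are the displayed polynomials in F13's `D₁…D₄` and `d` (nothing minted; `C′ := C′_{F18a} + C₃·E⁺·T`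
with r14's existential `E`).  (c) The extra hypothesis `0 ≤ tA`.  (d) Everything else as in F18a's/F15's HONEST SCOPE (value clause only;
general regions with cube size `K₀ ∣ M`; torus sub-family `Shape P`, odd `L > 1`; general (2.55) letters; `s ∈ (0, 1]`, `θ₁, θ₂, T, m′, κ`
free); the tower form carries F14's (a)–(c) verbatim (`□₂ ⊆ Λ₂^{(j)′}`, `□₁ ⊆ Λ₆^{(j)′}`, `Bᵏ(□₂)` a cell box of cube size `M` stay
hypotheses; room condition = the cell's reading (c) of GAPS G-B2-12; `bad`, `rad` data).  NOT summit progress.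
-/

open scoped BigOperators

noncomputable section

namespace Literature.MathematicalPhysics.QuantumFieldTheory.Balaban1983to89.B2Eq265PrintedSize

open HiggsLattice (ChargeData)
open HiggsAveraging (blockIter toFinest)
open HiggsCovariance (avgQkAdj)
open B2Eq255Concrete (bgScalar256 underRegion mem_underRegion Restr255)
open B2Eq265TailsScale (eq265_higgs_region_pow_scale)
open B2Eq324NestedRegions (prime)
open B2Eq243RegionsTower (towerRegion)
open B2Eq28RegionsConcrete (near)
open B2Eq28RegionsCollars (nbhd_towerRegion)
open B2Eq28RegionsBigBlockUnion (isBigBlockUnion_towerRegion_prime)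
open B2Eq267HiggsRegion (prime_towerRegion_six_subset_two)
open B2Ineq329BlockPoincare (blockIter_toFinest)
open B2Lemma23HiggsLattice (cutMin)
open B1Eq211ZeroFieldTorus (Shape)
open B3MultiscaleFields (toSite ofSite)
open B1Ineq225RegularBox (cellBox)
open B1TorusRegionHSizes (IsBigBlockUnion)
open B1TorusCubeCover (half)
open B1TorusCubeLocality26 (rS)

variable {P : HiggsLattice.Params} {k : ℕ}

/-! ## §1 The algebra of the grouping -/

/-- **THE GROUPING IDENTITY AS AN INEQUALITY.**  For non-negative reals with `0 < ℓ`, `ε·G ≤ d·ℓ` (`G = d(Lᵏ − 1)`, `ε(Lᵏ − 1) ≤ ℓ`): (2.68)'s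
term of F15's bound + the middle piece `aC₃·4K₀·(ℓeσt′·d)` of (2.76)'s term + the transport term `eεGσt′` is at most
`t′·(eσ)·ℓ·[a(E₁ + 4K₀dC₃) + d + E₂a² + (eσ)ℓa(E₂ + E₃a)]` with `E₁ = D₁d(1 + D₄) + D₂D₃`, `E₂ = 2D₁D₃d`, `E₃ = D₁D₃d²`
(equality when `εG = dℓ`). [cite: Balaban1982Higgs2, Lemma 2.4 proof (2.68) p.572, (2.76) p.573] -/
theorem bracket_le {a ℓ ε e σ G t d D₁ D₂ D₃ D₄ C₃ K₀ : ℝ} (ha : 0 ≤ a) (hℓ : 0 < ℓ) (hε : 0 ≤ ε) (he : 0 ≤ e) (hσ : 0 ≤ σ)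
    (hG : 0 ≤ G) (ht : 0 ≤ t) (hD₁ : 0 ≤ D₁) (hD₃ : 0 ≤ D₃) (hεG : ε * G ≤ d * ℓ) :
    D₁ * ℓ ^ 2 *
        (a * ℓ⁻¹ ^ 2 * (e * σ * ε * G) * t
          + e * σ * (d * ((a * ℓ⁻¹ ^ 2 * t * D₄ * ℓ + e * σ * (a * D₃ * t)) + e * σ * (a * D₃ * t)))
          + a * ℓ⁻¹ ^ 2 * ((2 * (e * σ * ε * G) + (e * σ * ε * G) ^ 2) * (a * D₃ * t)))
      + D₂ * ℓ * (e * σ * (a * D₃ * t))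
      + a * C₃ * (4 * K₀ * ((ℓ * e * σ * t) * d))
      + e * ε * G * σ * t
    ≤ t * (e * σ) * ℓ *
        (a * (D₁ * d * (1 + D₄) + D₂ * D₃ + 4 * K₀ * d * C₃) + d + 2 * D₁ * D₃ * d * a ^ 2
          + (e * σ) * ℓ * a * (2 * D₁ * D₃ * d + D₁ * D₃ * d ^ 2 * a)) := by
  have hℓ0 : ℓ ≠ 0 := hℓ.ne'
  -- the oscillation `M = eσ·εG` and its bound `M ≤ eσ·dℓ`
  have hM0 : 0 ≤ e * σ * ε * G := by positivity
  have hM : e * σ * ε * G ≤ e * σ * (d * ℓ) := by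
    calc e * σ * ε * G = (e * σ) * (ε * G) := by ring
      _ ≤ (e * σ) * (d * ℓ) := mul_le_mul_of_nonneg_left hεG (mul_nonneg he hσ)
  -- clear `ℓ²·ℓ⁻²`
  have hclear : D₁ * ℓ ^ 2 *
        (a * ℓ⁻¹ ^ 2 * (e * σ * ε * G) * t
          + e * σ * (d * ((a * ℓ⁻¹ ^ 2 * t * D₄ * ℓ + e * σ * (a * D₃ * t)) + e * σ * (a * D₃ * t)))
          + a * ℓ⁻¹ ^ 2 * ((2 * (e * σ * ε * G) + (e * σ * ε * G) ^ 2) * (a * D₃ * t)))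
      + D₂ * ℓ * (e * σ * (a * D₃ * t))
      + a * C₃ * (4 * K₀ * ((ℓ * e * σ * t) * d))
      + e * ε * G * σ * t
      = D₁ * (a * (e * σ * ε * G) * t + e * σ * (d * ((a * t * D₄ * ℓ + ℓ ^ 2 * (e * σ * (a * D₃ * t))) + ℓ ^ 2 * (e * σ * (a * D₃ * t))))
          + a * ((2 * (e * σ * ε * G) + (e * σ * ε * G) ^ 2) * (a * D₃ * t)))
        + D₂ * ℓ * (e * σ * (a * D₃ * t)) + a * C₃ * (4 * K₀ * ((ℓ * e * σ * t) * d)) + (e * σ * ε * G) * t := by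
    have hl : ℓ ^ 2 * ℓ⁻¹ ^ 2 = 1 := by field_simp
    linear_combination (D₁ * a * (e * σ * ε * G) * t + D₁ * (e * σ) * d * a * t * D₄ * ℓ
      + D₁ * a * ((2 * (e * σ * ε * G) + (e * σ * ε * G) ^ 2) * (a * D₃ * t))) * hl
  rw [hclear]
  calc D₁ * (a * (e * σ * ε * G) * t + e * σ * (d * ((a * t * D₄ * ℓ + ℓ ^ 2 * (e * σ * (a * D₃ * t))) + ℓ ^ 2 * (e * σ * (a * D₃ * t))))
          + a * ((2 * (e * σ * ε * G) + (e * σ * ε * G) ^ 2) * (a * D₃ * t)))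
        + D₂ * ℓ * (e * σ * (a * D₃ * t)) + a * C₃ * (4 * K₀ * ((ℓ * e * σ * t) * d)) + (e * σ * ε * G) * t
      ≤ D₁ * (a * (e * σ * (d * ℓ)) * t + e * σ * (d * ((a * t * D₄ * ℓ + ℓ ^ 2 * (e * σ * (a * D₃ * t))) + ℓ ^ 2 * (e * σ * (a * D₃ * t))))
          + a * ((2 * (e * σ * (d * ℓ)) + (e * σ * (d * ℓ)) ^ 2) * (a * D₃ * t)))
        + D₂ * ℓ * (e * σ * (a * D₃ * t)) + a * C₃ * (4 * K₀ * ((ℓ * e * σ * t) * d)) + (e * σ * (d * ℓ)) * t := by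
        gcongr
    _ = t * (e * σ) * ℓ *
        (a * (D₁ * d * (1 + D₄) + D₂ * D₃ + 4 * K₀ * d * C₃) + d + 2 * D₁ * D₃ * d * a ^ 2
          + (e * σ) * ℓ * a * (2 * D₁ * D₃ * d + D₁ * D₃ * d ^ 2 * a)) := by ring

/-! ## §2 (2.65)'s remainder grouped by printed sources -/

/-- **LEMMA 2.4 (2.65), VALUE CLAUSE — THE FIVE NON-TAIL TERMS GROUPED BY THEIR PRINTED SOURCES.**  TYPED vs PRINTED: own F18a
`B2Eq265TailsScale.eq265_higgs_region_pow_scale` word for word except the located edits listed in the header (`∃ E₁ E₂ E₃ ≥ 0`; `0 ≤ tA →`;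
the five non-tail terms of the bound ↦ `4K₀·d·C₃·a_k·λ_A` + `t′·X·ℓ·[a_k(E₁ + 4K₀dC₃) + d + E₂a_k² + Xℓa_k(E₂ + E₃a_k)]` + the (2.75)
mass ratio, in the lattice letters `ℓ = P.mesh k`, `λ_A = ℓ·c₁pℓ`, `X = |e|·δ_A·d·LᵏS`, `t′ = c₁·tPhi·pℓ`; tails `C′·a_k·s^κ` at the free
physical scale `s`, `C′` enlarged by the (2.76) tail).
[cite: Balaban1982Higgs2, Lemma 2.4 (2.65) p.572 «φ^{(k)}(x) = U(A^{(k)}(Γ^{(k)}_{x,y}))φ(y) + O(p(Lᵏε)) = (Q_k^*(A^{(k)})φ)(x) + O(p(Lᵏε)), for x ∈ Bᵏ(y), y ∈ Λ₇^{(k−1)′}»]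
[cite: Balaban1982Higgs2, Lemma 2.4 proof p.572 «From the property (2.60) we have the inequality |A^{(k)}(x) − A^{(k)}(y)| ≤ O(p(Lᵏε)r(Lᵏε)) … thus A^{(k)} − A₀ = O(p(Lᵏε)r(Lᵏε))», (2.68) p.572 «+ O((Lᵏε)^{κ₀}), κ₀ > 0», p.573 «|U(A₀(⟨y′, y″⟩))φ(y″) − φ(y′)| ≦ O(1)p(Lᵏε)» / «= |φ′(y″) − φ′(y′)| ≦ O(1)p(Lᵏε)», (2.75)–(2.76) p.573 «(a_kG_k(□, 0)Q_k^*□₁φ′)(x) = φ′(y) + O(p(Lᵏε)), x ∈ Bᵏ(y)», p.573 «taking into account the equalities φ′(y) = φ(y), U(A₀(Γ_{x,y}))φ(y) = U(A^{(k)}(Γ^{(k)}_{x,y}))φ(y) + O((Lᵏε)^{κ₀}) we finally get (2.65)»]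
[cite: Balaban1982Higgs2, (2.55)–(2.56) p.570, (2.7) p.558] -/
theorem eq265_higgs_region_size (d L : ℕ) (hd : 1 ≤ d) (hL : Odd L ∧ 1 < L) {a : ℝ} (ha : 0 < a) {msq : ℝ} (hmsq : 0 < msq)
    {aV : ℝ} (haV : 0 < aV) {mu0sq : ℝ} (hmu0 : 0 < mu0sq)
    (N : ℕ) (C : ChargeData N) (ε₀ : ℝ) (creg β : ℝ) (hcreg : 0 ≤ creg) (hβ : 0 < β)
    (Q : B2.Params) (hQ : Q.Printed) {T : ℝ} (hT : 0 ≤ T) (mexp : ℝ) {θ₁ θ₂ : ℝ} (hθ₁ : 0 < θ₁) (hθ₂ : 0 < θ₂) (κ : ℝ) :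
    ∃ δ CV CF : ℝ, 0 < δ ∧ 0 < CV ∧ 0 < CF ∧
    ∃ K₀min : ℕ, ∀ K₀ : ℕ, K₀min ≤ K₀ → ∃ e₁ t : ℝ, 0 < e₁ ∧ 0 < t ∧
      ∃ C₁ C₂ C₃ D₁ D₂ D₃ D₄ : ℝ, 0 ≤ C₁ ∧ 0 ≤ C₂ ∧ 0 ≤ C₃ ∧ 0 ≤ D₁ ∧ 0 ≤ D₂ ∧ 0 ≤ D₃ ∧ 0 ≤ D₄ ∧ ∃ C' : ℝ, 0 ≤ C' ∧
      ∃ E₁ E₂ E₃ : ℝ, 0 ≤ E₁ ∧ 0 ≤ E₂ ∧ 0 ≤ E₃ ∧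
      ∀ (P : HiggsLattice.Params) (_ : Shape P), P.d = d → P.L = L → K₀ ∣ P.M →
      ∀ {k : ℕ}, 1 ≤ k → k ≤ P.K → (∀ μ, 3 * half P k K₀ ≤ P.sitesPerDir 0 μ) → P.mesh k ≤ ε₀ → P.mesh k ≤ 1 →
      ∀ (Λ₂ Λ₆ sq₂ sq₁ : Finset (HiggsLattice.Site P k)) (S : Fin P.d → Finset ℕ) (q : HiggsLattice.Site P k) (Sbox : ℕ),
        Λ₆ ⊆ Λ₂ → sq₂ ⊆ Λ₂ → sq₁ ⊆ Λ₆ →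
        IsBigBlockUnion k K₀ (underRegion k Λ₂) → underRegion k sq₂ = cellBox k K₀ S →
        (∀ μ : Fin P.d, P.L ^ k * Sbox < P.sitesPerDir 0 μ) →
      -- `□₂` IS the box `q + [0,S)ᵈ` of coarse sites, `□ = B^k(□₂)` smaller than half the torus
        (∀ y : HiggsLattice.Site P k, y ∈ sq₂ ↔ ∀ ν : Fin P.d, (y ν - q ν).val < Sbox) →
        (∀ μ : Fin P.d, 2 * (P.L ^ k * Sbox) ≤ P.sitesPerDir 0 μ) →
      -- `□₁` is the box of coarse sites of radius `R₁` (corner `q₁`); `m ≥ R₁` a coarse margin with `Lᵏm ≥` the depth radius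
      ∀ (q₁ : HiggsLattice.Site P k) (R₁ m : ℕ), R₁ ≤ m → 2 * rS P k K₀ + 2 * half P k K₀ * (P.d + 1) + 1 ≤ P.L ^ k * m →
        (∀ y : HiggsLattice.Site P k, y ∈ sq₁ ↔ ∀ ν : Fin P.d, (y ν - q₁ ν).val < 2 * R₁ + 1) →
      -- the region `Λ₋₁` of (2.55); the cutoff `ζ^{(k)}` of (2.44); the cube of radius `R_n ≥ ρ + 1` about every `y ∈ Λ₂` inside `Λ₋₁` ((2.8))
      ∀ (Λm1 : Finset (HiggsLattice.Site P k))
        (ζ : HiggsLattice.Site P 0 → HiggsLattice.Site P k → ℝ) (ρ ρ₁ : ℝ), 0 ≤ ρ₁ →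
        (∀ x y', |ζ x y'| ≤ 1) →
        (∀ x y', ζ x y' ≠ 0 → (HiggsLattice.Site.tdist (blockIter k x) y' : ℝ) ≤ ρ) →
        (∀ x y', (HiggsLattice.Site.tdist (blockIter k x) y' : ℝ) ≤ ρ₁ → ζ x y' = 1) →
        (∀ (x : HiggsLattice.Site P 0) (ν : Fin P.d) (y' : HiggsLattice.Site P k), |ζ (x.shift ν) y' - ζ x y'| ≤ ((P.L : ℝ) ^ k)⁻¹) →
      ∀ (Rn : ℕ), ρ + 1 ≤ (Rn : ℝ) → (∀ μ : Fin P.d, 2 * (2 * Rn + 1) ≤ P.sitesPerDir k μ) →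
        (∀ y ∈ Λ₂, ∀ y' : HiggsLattice.Site P k, HiggsLattice.Site.tdist y y' ≤ Rn → y' ∈ Λm1) →
      -- a charge datum on `ℝ^d`, the step's vector field `A′`, and the letters of (2.55)
      ∀ (C₀ : ChargeData P.d) (A' : HiggsLattice.VecField P k) {c₁ pℓ tA tPhi : ℝ}, 0 ≤ c₁ → 0 ≤ pℓ → 0 ≤ tPhi → 0 ≤ tA →
      -- THE PHYSICAL SCALE `s ⇐ Lᵏε` AS A FREE LETTER (F18a): radii readings `m ≥ θ₁r(s)`, `R₁ + 1 ≥ θ₂r(s)` and threshold size `c₁·tPhi·pℓ ≤ T·s^{−m′}`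
      ∀ {s : ℝ}, 0 < s → s ≤ 1 →
        θ₁ * B2.rFn Q.R Q.r s ≤ (m : ℝ) → θ₂ * B2.rFn Q.R Q.r s ≤ (R₁ : ℝ) + 1 →
        c₁ * tPhi * pℓ ≤ T * s ^ (-mexp) →
      -- `δA` is at least the (2.60) bound read off (2.55)₁,₂, and small in the two printed scalings
      ∀ {δA : ℝ}, ((P.L : ℝ) ^ k)⁻¹ * (CV * P.d * (P.mesh k * (c₁ * pℓ)) + CF * Real.exp (-(δ * ρ₁)) * (c₁ * tA * pℓ)) ≤ δA →
          (P.L : ℝ) ^ k * δA * |C.e| ≤ t →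
        ∀ {ec : ℝ}, 0 < ec → ec ≤ e₁ → (P.L : ℝ) ^ k * P.mesh k * |C.e| * δA ≤ creg * ec ^ β →
      -- `x ∈ Bᵏ(ȳ)` with `ȳ` the centre of `□₁` and at least `m` inside `□₂` in every direction
      ∀ (x : HiggsLattice.Site P 0),
        (∀ ν : Fin P.d, m ≤ ((blockIter k x) ν - q ν).val ∧ ((blockIter k x) ν - q ν).val + m < Sbox) →
        (∀ ν : Fin P.d, ((blockIter k x) ν - q₁ ν).val = R₁) →
      -- THE RESTRICTIONS (2.55) on `Λ₋₁` for the fields `A′, φ` of the step and the background `A^{(k)} = a_kζ^{(k)}G_kQ_k^*A′` — all four conjuncts used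
      ∀ (φ : HiggsLattice.ScalarField P k N),
        Restr255 C c₁ pℓ tA tPhi k Λm1 A' φ (ofSite (cutMin C₀ mu0sq aV k ζ (toSite A'))) →
        ‖bgScalar256 C msq a k Λ₂ Λ₆ (ofSite (cutMin C₀ mu0sq aV k ζ (toSite A'))) φ x
            - avgQkAdj C (ofSite (cutMin C₀ mu0sq aV k ζ (toSite A'))) k φ x‖
          ≤ C' * B1.aSeq a P.L k * s ^ κ
            + 4 * K₀ * P.d * C₃ * B1.aSeq a P.L k * (P.mesh k * (c₁ * pℓ))
            + (c₁ * tPhi * pℓ) * (|C.e| * (δA * (P.d * ((P.L : ℝ) ^ k * Sbox)))) * P.mesh k *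
                (B1.aSeq a P.L k * (E₁ + 4 * K₀ * P.d * C₃) + P.d + E₂ * B1.aSeq a P.L k ^ 2
                  + (|C.e| * (δA * (P.d * ((P.L : ℝ) ^ k * Sbox)))) * P.mesh k * B1.aSeq a P.L k * (E₂ + E₃ * B1.aSeq a P.L k))
            + msq * P.mesh k ^ 2 / (B1.aSeq a P.L k + msq * P.mesh k ^ 2) * (c₁ * tPhi * pℓ) := by
  obtain ⟨δ, CV, CF, hδ, hCV, hCF, K₀min, h⟩ :=
    eq265_higgs_region_pow_scale d L hd hL ha hmsq haV hmu0 N C ε₀ creg β hcreg hβ Q hQ hT mexp hθ₁ hθ₂ κ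
  refine ⟨δ, CV, CF, hδ, hCV, hCF, max K₀min 1, fun K₀ hK₀ => ?_⟩
  obtain ⟨e₁, t, he₁, ht, C₁, C₂, C₃, D₁, D₂, D₃, D₄, hC₁, hC₂, hC₃, hD₁, hD₂, hD₃, hD₄, C', hC', h⟩ := h K₀ ((le_max_left _ _).trans hK₀)
  have hK₀1 : (1 : ℝ) ≤ K₀ := by exact_mod_cast (le_max_right _ _).trans hK₀
  have hK₀0 : (0 : ℝ) ≤ K₀ := zero_le_one.trans hK₀1
  have hδ₀ : (0 : ℝ) < 1 / (4 * K₀) := by positivity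
  have hr₂ : (0 : ℝ) < θ₂ * (1 / (4 * K₀)) := by positivity
  obtain ⟨E, hE⟩ := B2StepK.rDecayBeatsPowers_of_printed Q hQ hr₂ (κ + mexp)
  have hd0 : (0 : ℝ) ≤ d := by positivity
  refine ⟨e₁, t, he₁, ht, C₁, C₂, C₃, D₁, D₂, D₃, D₄, hC₁, hC₂, hC₃, hD₁, hD₂, hD₃, hD₄, C' + C₃ * max E 0 * T, by positivity,
    D₁ * d * (1 + D₄) + D₂ * D₃, 2 * D₁ * D₃ * d, D₁ * D₃ * d ^ 2, by positivity, by positivity, by positivity, ?_⟩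
  intro P S hPd hPL hK₀M k hk1 hkK h3 hε h1 Λ₂ Λ₆ sq₂ sq₁ Sfin q Sbox h62 hs2 h16 hΩΛ hbox hSbox hsq₂ h2S q₁ R₁ m hR₁m hRm hsq₁
    Λm1 ζ ρ ρ₁ hρ₁ zeta_abs zeta_supp zeta_one zeta_lip Rn hRn hRn2 hcube C₀ A' c₁ pℓ tA tPhi hc₁ hpℓ htPhi htA s hs hs1 hθm hθR htT
    δA h60δ ht' ec hec hle hsmall x hmargin hcentre φ h255
  have hmain := h P S hPd hPL hK₀M hk1 hkK h3 hε h1 Λ₂ Λ₆ sq₂ sq₁ Sfin q Sbox h62 hs2 h16 hΩΛ hbox hSbox hsq₂ h2S q₁ R₁ m hR₁m hRm hsq₁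
    Λm1 ζ ρ ρ₁ hρ₁ zeta_abs zeta_supp zeta_one zeta_lip Rn hRn hRn2 hcube C₀ A' hc₁ hpℓ htPhi hs hs1 hθm hθR htT h60δ ht' hec hle hsmall
    x hmargin hcentre φ h255
  subst hPd
  -- the letters and their signs
  have hℓ : 0 < P.mesh k := P.mesh_pos k
  have hLr : 1 < (P.L : ℝ) := by rw [hPL]; exact_mod_cast hL.2
  have hA : 0 ≤ B1.aSeq a P.L k := (B1.aSeq_pos ha hLr hk1).le
  have ht0 : 0 ≤ c₁ * tPhi * pℓ := mul_nonneg (mul_nonneg hc₁ htPhi) hpℓ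
  have hLk1 : (1 : ℝ) ≤ (P.L : ℝ) ^ k := one_le_pow₀ hLr.le
  have hG : (0 : ℝ) ≤ (P.d : ℝ) * ((P.L : ℝ) ^ k - 1) := mul_nonneg (Nat.cast_nonneg _) (by linarith)
  have hδA : 0 ≤ δA := by
    refine le_trans ?_ h60δ
    have : 0 ≤ CV * P.d * (P.mesh k * (c₁ * pℓ)) + CF * Real.exp (-(δ * ρ₁)) * (c₁ * tA * pℓ) := by
      have h1' : 0 ≤ CV * P.d * (P.mesh k * (c₁ * pℓ)) := by positivity
      have h2' : 0 ≤ CF * Real.exp (-(δ * ρ₁)) * (c₁ * tA * pℓ) := by positivity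
      linarith
    positivity
  have hσ : 0 ≤ δA * (P.d * ((P.L : ℝ) ^ k * Sbox)) := by positivity
  have hεG : P.mesh 0 * ((P.d : ℝ) * ((P.L : ℝ) ^ k - 1)) ≤ (P.d : ℝ) * P.mesh k := by
    have hm : P.mesh 0 * (P.L : ℝ) ^ k = P.mesh k := by
      simp only [HiggsLattice.Params.mesh, pow_zero, one_mul]; ring
    have hε0 : 0 ≤ P.mesh 0 := (P.mesh_pos 0).le
    calc P.mesh 0 * ((P.d : ℝ) * ((P.L : ℝ) ^ k - 1)) = (P.d : ℝ) * (P.mesh 0 * (P.L : ℝ) ^ k) - (P.d : ℝ) * P.mesh 0 := by ring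
      _ = (P.d : ℝ) * P.mesh k - (P.d : ℝ) * P.mesh 0 := by rw [hm]
      _ ≤ (P.d : ℝ) * P.mesh k := sub_le_self _ (mul_nonneg (Nat.cast_nonneg _) hε0)
  -- (2.76)'s tail beats every power of the physical scale `s`, as the (2.67) tails did in F18a/F15
  have hR' : θ₂ * (1 / (4 * K₀)) * B2.rFn Q.R Q.r s ≤ 1 / (4 * K₀) * ((R₁ : ℝ) + 1) := by
    have h' := mul_le_mul_of_nonneg_left hθR hδ₀.le
    calc θ₂ * (1 / (4 * K₀)) * B2.rFn Q.R Q.r s = 1 / (4 * K₀) * (θ₂ * B2.rFn Q.R Q.r s) := by ring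
      _ ≤ 1 / (4 * K₀) * ((R₁ : ℝ) + 1) := h'
  have hex : Real.exp (-(1 / (4 * K₀) * ((R₁ : ℝ) + 1))) ≤ max E 0 * s ^ (κ + mexp) := by
    calc Real.exp (-(1 / (4 * K₀) * ((R₁ : ℝ) + 1))) ≤ Real.exp (-(θ₂ * (1 / (4 * K₀)) * B2.rFn Q.R Q.r s)) :=
          Real.exp_le_exp.mpr (neg_le_neg hR')
      _ ≤ E * s ^ (κ + mexp) := hE s hs hs1
      _ ≤ max E 0 * s ^ (κ + mexp) := mul_le_mul_of_nonneg_right (le_max_left _ _) (Real.rpow_nonneg hs.le _)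
  have hpow : s ^ (-mexp) * s ^ (κ + mexp) = s ^ κ := by
    rw [← Real.rpow_add hs]; ring_nf
  have htail : B1.aSeq a P.L k * C₃ * (Real.exp (-(1 / (4 * K₀) * ((R₁ : ℝ) + 1))) * (c₁ * tPhi * pℓ))
      ≤ C₃ * max E 0 * T * B1.aSeq a P.L k * s ^ κ := by
    calc B1.aSeq a P.L k * C₃ * (Real.exp (-(1 / (4 * K₀) * ((R₁ : ℝ) + 1))) * (c₁ * tPhi * pℓ))
        ≤ B1.aSeq a P.L k * C₃ * ((max E 0 * s ^ (κ + mexp)) * (T * s ^ (-mexp))) :=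
          mul_le_mul_of_nonneg_left (mul_le_mul hex htT ht0 (mul_nonneg (le_max_right _ _) (Real.rpow_nonneg hs.le _)))
            (mul_nonneg hA hC₃)
      _ = C₃ * max E 0 * T * B1.aSeq a P.L k * (s ^ (-mexp) * s ^ (κ + mexp)) := by ring
      _ = C₃ * max E 0 * T * B1.aSeq a P.L k * s ^ κ := by rw [hpow]
  -- the grouping of (2.68) + (2.76)'s middle piece + the transport term
  have hbr := bracket_le (D₂ := D₂) (D₄ := D₄) (C₃ := C₃) (K₀ := (K₀ : ℝ)) hA hℓ (P.mesh_pos 0).le (abs_nonneg C.e) hσ hG ht0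
    hD₁ hD₃ hεG
  -- assemble: (2.76)'s term splits into `4K₀dC₃a·λ_A` + its middle piece + its tail; the groups compare one by one
  linear_combination hmain + hbr + htail

/-! ## §3 The same for print's own tower regions -/

/-- **LEMMA 2.4 (2.65), VALUE CLAUSE, FOR PRINT'S OWN REGIONS `Λ₂^{(k−1)′} ⊇ Λ₆^{(k−1)′}`, `Λ₋₁^{(k−1)′} ⊇ (near Λ₀^{(k−1)} r)′`, cube
size `K₀ = M` — THE FIVE NON-TAIL TERMS GROUPED BY THEIR PRINTED SOURCES.**  TYPED vs PRINTED: own F18a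
`B2Eq265TailsScale.eq265_higgs_tower_pow_scale` word for word except the located edits of `eq265_higgs_region_size` (`∃ E₁ E₂ E₃ ≥ 0`;
`0 ≤ tA →`; the five non-tail terms ↦ the three groups, with `K₀ ↦ M`, level `j + 1`); equivalently `eq265_higgs_region_size` with F14's
located edits (`∃ Mmin ∀ M ≥ Mmin … P.M = M`; tower data `(bad) (rad), 0 < rad j →`, `Λ₂ := prime (towerRegion bad rad j 2)`,
`Λ₆ := prime (towerRegion bad rad j 6)`, `Λm1 := prime (near (towerRegion bad rad j 0) (rad j))`; cube condition ↦ `∀ (n : ℕ), n < rad j →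
L(R_n + 1) − 1 ≤ 3n →`), from which it is derived; `rad` stays data; nothing minted.
[cite: Balaban1982Higgs2, Lemma 2.4 (2.65) p.572, (2.68) p.572, (2.75)–(2.76) p.573] [cite: Balaban1982Higgs2, (2.56) p.570, (2.55) p.570, (2.7)–(2.8) p.558, (2.43) p.566]
[cite: Balaban1982Higgs1, Prop. 2.1 p.610 «let Ω^{(k)} ⊂ T^{(k)}_1 be a sum of big blocks with M sufficiently large»] -/
theorem eq265_higgs_tower_size (d L : ℕ) (hd : 1 ≤ d) (hL : Odd L ∧ 1 < L) {a : ℝ} (ha : 0 < a) {msq : ℝ} (hmsq : 0 < msq)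
    {aV : ℝ} (haV : 0 < aV) {mu0sq : ℝ} (hmu0 : 0 < mu0sq)
    (N : ℕ) (C : ChargeData N) (ε₀ : ℝ) (creg β : ℝ) (hcreg : 0 ≤ creg) (hβ : 0 < β)
    (Q : B2.Params) (hQ : Q.Printed) {T : ℝ} (hT : 0 ≤ T) (mexp : ℝ) {θ₁ θ₂ : ℝ} (hθ₁ : 0 < θ₁) (hθ₂ : 0 < θ₂) (κ : ℝ) :
    ∃ δ CV CF : ℝ, 0 < δ ∧ 0 < CV ∧ 0 < CF ∧
    ∃ Mmin : ℕ, ∀ M : ℕ, Mmin ≤ M → ∃ e₁ t : ℝ, 0 < e₁ ∧ 0 < t ∧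
      ∃ C₁ C₂ C₃ D₁ D₂ D₃ D₄ : ℝ, 0 ≤ C₁ ∧ 0 ≤ C₂ ∧ 0 ≤ C₃ ∧ 0 ≤ D₁ ∧ 0 ≤ D₂ ∧ 0 ≤ D₃ ∧ 0 ≤ D₄ ∧ ∃ C' : ℝ, 0 ≤ C' ∧
      ∃ E₁ E₂ E₃ : ℝ, 0 ≤ E₁ ∧ 0 ≤ E₂ ∧ 0 ≤ E₃ ∧
      ∀ (P : HiggsLattice.Params) (_ : Shape P), P.d = d → P.L = L → P.M = M →
      ∀ {j : ℕ}, j + 1 ≤ P.K → (∀ μ, 3 * half P (j + 1) M ≤ P.sitesPerDir 0 μ) → P.mesh (j + 1) ≤ ε₀ → P.mesh (j + 1) ≤ 1 →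
      -- PRINT'S OWN REGIONS: the (2.7)–(2.8)/(2.43) tower of step `j`, primed to `T^{(k)}`, `k = j + 1`; `Λ₂′ ⊇ □₂`, `Λ₆′ ⊇ □₁`
      ∀ (bad : (l : ℕ) → Set (HiggsLattice.Site P l)) (rad : ℕ → ℝ), 0 < rad j →
      ∀ (sq₂ sq₁ : Finset (HiggsLattice.Site P (j + 1))) (S : Fin P.d → Finset ℕ) (q : HiggsLattice.Site P (j + 1)) (Sbox : ℕ),
        sq₂ ⊆ prime (towerRegion bad rad j 2) → sq₁ ⊆ prime (towerRegion bad rad j 6) →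
        underRegion (j + 1) sq₂ = cellBox (j + 1) M S →
        (∀ μ : Fin P.d, P.L ^ (j + 1) * Sbox < P.sitesPerDir 0 μ) →
      -- `□₂` IS the box `q + [0,S)ᵈ` of coarse sites, `□ = B^k(□₂)` smaller than half the torus
        (∀ y : HiggsLattice.Site P (j + 1), y ∈ sq₂ ↔ ∀ ν : Fin P.d, (y ν - q ν).val < Sbox) →
        (∀ μ : Fin P.d, 2 * (P.L ^ (j + 1) * Sbox) ≤ P.sitesPerDir 0 μ) →
      -- `□₁` is the box of coarse sites of radius `R₁` (corner `q₁`); `m ≥ R₁` a coarse margin with `Lᵏm ≥` the depth radius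
      ∀ (q₁ : HiggsLattice.Site P (j + 1)) (R₁ m : ℕ), R₁ ≤ m → 2 * rS P (j + 1) M + 2 * half P (j + 1) M * (P.d + 1) + 1 ≤ P.L ^ (j + 1) * m →
        (∀ y : HiggsLattice.Site P (j + 1), y ∈ sq₁ ↔ ∀ ν : Fin P.d, (y ν - q₁ ν).val < 2 * R₁ + 1) →
      -- the cutoff `ζ^{(k)}` of (2.44)
      ∀ (ζ : HiggsLattice.Site P 0 → HiggsLattice.Site P (j + 1) → ℝ) (ρ ρ₁ : ℝ), 0 ≤ ρ₁ →
        (∀ x y', |ζ x y'| ≤ 1) →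
        (∀ x y', ζ x y' ≠ 0 → (HiggsLattice.Site.tdist (blockIter (j + 1) x) y' : ℝ) ≤ ρ) →
        (∀ x y', (HiggsLattice.Site.tdist (blockIter (j + 1) x) y' : ℝ) ≤ ρ₁ → ζ x y' = 1) →
        (∀ (x : HiggsLattice.Site P 0) (ν : Fin P.d) (y' : HiggsLattice.Site P (j + 1)), |ζ (x.shift ν) y' - ζ x y'| ≤ ((P.L : ℝ) ^ (j + 1))⁻¹) →
      -- the cube of radius `R_n ≥ ρ + 1` about `y ∈ Λ₂′` lies in `Λ₋₁′ := (near Λ₀^{(j)} r(Lʲε))′` once `L(R_n + 1) − 1 ≤ 3n`, `n < r(Lʲε)` ((2.8) collars)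
      ∀ (Rn : ℕ), ρ + 1 ≤ (Rn : ℝ) → (∀ μ : Fin P.d, 2 * (2 * Rn + 1) ≤ P.sitesPerDir (j + 1) μ) →
      ∀ (n : ℕ), (n : ℝ) < rad j → (P.L : ℝ) * ((Rn : ℝ) + 1) - 1 ≤ 3 * (n : ℝ) →
      -- a charge datum on `ℝ^d`, the step's vector field `A′`, and the letters of (2.55)
      ∀ (C₀ : ChargeData P.d) (A' : HiggsLattice.VecField P (j + 1)) {c₁ pℓ tA tPhi : ℝ}, 0 ≤ c₁ → 0 ≤ pℓ → 0 ≤ tPhi → 0 ≤ tA →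
      -- THE PHYSICAL SCALE `s ⇐ Lᵏε` AS A FREE LETTER (F18a): radii readings and threshold size at `s`
      ∀ {s : ℝ}, 0 < s → s ≤ 1 →
        θ₁ * B2.rFn Q.R Q.r s ≤ (m : ℝ) → θ₂ * B2.rFn Q.R Q.r s ≤ (R₁ : ℝ) + 1 →
        c₁ * tPhi * pℓ ≤ T * s ^ (-mexp) →
      -- `δA` is at least the (2.60) bound read off (2.55)₁,₂, and small in the two printed scalings
      ∀ {δA : ℝ}, ((P.L : ℝ) ^ (j + 1))⁻¹ * (CV * P.d * (P.mesh (j + 1) * (c₁ * pℓ)) + CF * Real.exp (-(δ * ρ₁)) * (c₁ * tA * pℓ)) ≤ δA →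
          (P.L : ℝ) ^ (j + 1) * δA * |C.e| ≤ t →
        ∀ {ec : ℝ}, 0 < ec → ec ≤ e₁ → (P.L : ℝ) ^ (j + 1) * P.mesh (j + 1) * |C.e| * δA ≤ creg * ec ^ β →
      -- `x ∈ Bᵏ(ȳ)` with `ȳ` the centre of `□₁` and at least `m` inside `□₂` in every direction
      ∀ (x : HiggsLattice.Site P 0),
        (∀ ν : Fin P.d, m ≤ ((blockIter (j + 1) x) ν - q ν).val ∧ ((blockIter (j + 1) x) ν - q ν).val + m < Sbox) →
        (∀ ν : Fin P.d, ((blockIter (j + 1) x) ν - q₁ ν).val = R₁) →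
      -- THE RESTRICTIONS (2.55) on `Λ₋₁` for the fields `A′, φ` of the step and the background `A^{(k)} = a_kζ^{(k)}G_kQ_k^*A′` — all four conjuncts used
      ∀ (φ : HiggsLattice.ScalarField P (j + 1) N),
        Restr255 C c₁ pℓ tA tPhi (j + 1) (prime (near (towerRegion bad rad j 0) (rad j))) A' φ
          (ofSite (cutMin C₀ mu0sq aV (j + 1) ζ (toSite A'))) →
        ‖bgScalar256 C msq a (j + 1) (prime (towerRegion bad rad j 2)) (prime (towerRegion bad rad j 6))
              (ofSite (cutMin C₀ mu0sq aV (j + 1) ζ (toSite A'))) φ x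
            - avgQkAdj C (ofSite (cutMin C₀ mu0sq aV (j + 1) ζ (toSite A'))) (j + 1) φ x‖
          ≤ C' * B1.aSeq a P.L (j + 1) * s ^ κ
            + 4 * M * P.d * C₃ * B1.aSeq a P.L (j + 1) * (P.mesh (j + 1) * (c₁ * pℓ))
            + (c₁ * tPhi * pℓ) * (|C.e| * (δA * (P.d * ((P.L : ℝ) ^ (j + 1) * Sbox)))) * P.mesh (j + 1) *
                (B1.aSeq a P.L (j + 1) * (E₁ + 4 * M * P.d * C₃) + P.d + E₂ * B1.aSeq a P.L (j + 1) ^ 2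
                  + (|C.e| * (δA * (P.d * ((P.L : ℝ) ^ (j + 1) * Sbox)))) * P.mesh (j + 1) * B1.aSeq a P.L (j + 1) * (E₂ + E₃ * B1.aSeq a P.L (j + 1)))
            + msq * P.mesh (j + 1) ^ 2 / (B1.aSeq a P.L (j + 1) + msq * P.mesh (j + 1) ^ 2) * (c₁ * tPhi * pℓ) := by
  obtain ⟨δ, CV, CF, hδ, hCV, hCF, K₀min, h⟩ :=
    eq265_higgs_region_size d L hd hL ha hmsq haV hmu0 N C ε₀ creg β hcreg hβ Q hQ hT mexp hθ₁ hθ₂ κ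
  refine ⟨δ, CV, CF, hδ, hCV, hCF, K₀min, fun M hM => ?_⟩
  obtain ⟨e₁, t, he₁, ht, C₁, C₂, C₃, D₁, D₂, D₃, D₄, hC₁, hC₂, hC₃, hD₁, hD₂, hD₃, hD₄, C', hC', E₁, E₂, E₃, hE₁, hE₂, hE₃, h⟩ :=
    h M hM
  refine ⟨e₁, t, he₁, ht, C₁, C₂, C₃, D₁, D₂, D₃, D₄, hC₁, hC₂, hC₃, hD₁, hD₂, hD₃, hD₄, C', hC', E₁, E₂, E₃, hE₁, hE₂, hE₃, ?_⟩
  intro P S hPd hPL hPM j hjK h3 hε h1 bad rad hrad sq₂ sq₁ Sfin q Sbox hs2 h16 hbox hSbox hsq₂ h2S q₁ R₁ m hR₁m hRm hsq₁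
    ζ ρ ρ₁ hρ₁ zeta_abs zeta_supp zeta_one zeta_lip Rn hRn hRn2 n hn hroom C₀ A' c₁ pℓ tA tPhi hc₁ hpℓ htPhi htA s hs hs1 hθm hθR
    htT δA h60δ ht' ec hec hle hsmall x hmargin hcentre φ h255
  -- the tower supplies: `M ∣ M`, `Λ₆′ ⊆ Λ₂′`, `Bᵏ(Λ₂′)` a big-block union of cube size `M`, and the cube condition into `Λ₋₁′`
  have hdvd : M ∣ P.M := hPM ▸ dvd_refl _
  have h62 : prime (towerRegion bad rad j 6) ⊆ prime (towerRegion bad rad j 2) := prime_towerRegion_six_subset_two bad hrad.le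
  have hΩ : IsBigBlockUnion (j + 1) M (underRegion (j + 1) (prime (towerRegion bad rad j 2))) :=
    hPM ▸ isBigBlockUnion_towerRegion_prime bad rad j 2
  have hjK' : j < P.K := hjK
  have hcube : ∀ y ∈ prime (towerRegion bad rad j 2), ∀ y' : HiggsLattice.Site P (j + 1),
      HiggsLattice.Site.tdist y y' ≤ Rn → y' ∈ prime (near (towerRegion bad rad j 0) (rad j)) := by
    intro y hy y' hyy'
    have hx : blockIter (j + 1) (toFinest y) ∈ prime (towerRegion bad rad j 2) := by rwa [blockIter_toFinest hjK]
    have hd' : (HiggsLattice.Site.tdist (blockIter (j + 1) (toFinest y)) y' : ℝ) ≤ ((Rn : ℝ) - 1) + 1 := by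
      rw [blockIter_toFinest hjK]; linarith [show (HiggsLattice.Site.tdist y y' : ℝ) ≤ Rn by exact_mod_cast hyy']
    have hroom' : (P.L : ℝ) * (((Rn : ℝ) - 1) + 2) - 1 ≤ 3 * (n : ℝ) := by linarith
    exact nbhd_towerRegion hjK' hrad.le hn hroom' (toFinest y) y' hx hd'
  exact h P S hPd hPL hdvd (Nat.succ_le_succ (Nat.zero_le j)) hjK h3 hε h1 _ _ sq₂ sq₁ Sfin q Sbox h62 hs2 h16 hΩ hbox hSbox hsq₂
    h2S q₁ R₁ m hR₁m hRm hsq₁ _ ζ ρ ρ₁ hρ₁ zeta_abs zeta_supp zeta_one zeta_lip Rn hRn hRn2 hcube C₀ A' hc₁ hpℓ htPhi htA hs hs1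
    hθm hθR htT h60δ ht' hec hle hsmall x hmargin hcentre φ h255

end Literature.MathematicalPhysics.QuantumFieldTheory.Balaban1983to89.B2Eq265PrintedSize

end
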